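import Literature.AlgebraicGeometry.Frobenioids.BirationalTowerBaseDeg
import Literature.AlgebraicGeometry.Frobenioids.BaseDegSquareIstr
import HarnessLib

/-!
# Frobenioids I, Corollary 4.12 — ASSEMBLY for general Frobenioids: the isotropic-type reduction
# (Thm. 3.4 (i)) composed with the birational tower (Cor. 4.10, Thm. 3.4 (iv), Prop. 3.11 (i))

Mochizuki, *The geometry of Frobenioids I: the general theory*, Kyushu J. Math. **62** (2008)
293–400, kurims text, proof of Cor. 4.12 p. 95 ll. 18–40 [cite: MochizukiFrdI2008, Cor. 4.12 p.95].

PROOF-ONLY (cell sub-DAG W9 = `plan/L1/SUBDAG-FrdI-Cor412.md`, rows C412-L00 + L10b composed; seat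
abc-iut-w5-d222). `BirationalTowerBaseDeg.lean` proves the typed Cor. 4.12 in print's reduced case
("`C₁`, `C₂` of isotropic type", p. 95 l. 19) from the named fact [FrdI] Thm. 3.4 (iv) (`FrdI.Thm34iv`);
`BaseDegSquareIstr.lean` proves that the `F_{0_D}`-square for `Ψ` descends from the one for
`Ψ^istr : C₁^istr ⥲ C₂^istr` along the isotropification functors (Thm. 3.4 (i), Prop. 1.9 (v)). Here:

* `FrdI.exists_toBaseDeg_equivalence_of_thm34iv`: the `F_{0_D}`-SQUARE (an equivalence `Ψ⁰` `1`-commuting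
  with `Ψ` over `C_i → F_{0_{D_i}}`) for Frobenioids of isotropic type, from `FrdI.Thm34iv` applied to
  `Ψ^birat` (the square-level content of `FrdI.cor412_of_thm34iv`);
* `FrdI.cor412_of_thm34iv_istr`: **the typed Cor. 4.12 for an ARBITRARY pair of Frobenioids** `C_i → F_{Φ_i}`
  and an equivalence `Ψ` with a restriction `Ψ^istr` compatible with the isotropifications (Thm. 3.4 (i)),
  GIVEN the named fact `FrdI.Thm34iv` and the printed inputs at `C_i^istr`: THE birationalizations
  `(C_i^istr)^birat` with their Frobenioid structures (Prop. 4.4 (ii), `hB_i` — the hypothesis of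
  `UnitTrivializationFrobeniusCompact.lean` / `DivisorMonoidBirationalProp48iii.lean` verbatim) of standard
  type (Prop. 4.8 (iii): `prop48iii_of_frobeniusCompact`, its conclusion verbatim), Frobenius-slim bases
  (the hypothesis of Cor. 4.12), and `Ψ^istr`, `(Ψ^istr)⁻¹` preserving co-angular pre-steps (Thm. 3.4 (ii))
  and base-isomorphisms (Thm. 3.4 (iii)).

No statement of the paper is restated as a `Prop` or strengthened; nothing here is specific to the abc
programme or bears on [IUTchIII] Cor. 3.12.
-/

namespace Literature.AlgebraicGeometry.Frobenioids

open CategoryTheory Opposite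

universe w v v' u u'

namespace FrdI

open PreFrobenioid

section Isotropic

variable {D₁ : Type u} [Category.{v} D₁] {Φ₁ : D₁ᵒᵖ ⥤ CommMonCat.{w}}
  {C₁ : Type u'} [Category.{v'} C₁] {F₁ : C₁ ⥤ ElemFrobenioid Φ₁}
  {D₂ : Type u} [Category.{v} D₂] {Φ₂ : D₂ᵒᵖ ⥤ CommMonCat.{w}}
  {C₂ : Type u'} [Category.{v'} C₂] {F₂ : C₂ ⥤ ElemFrobenioid Φ₂}

/-- **The `F_{0_D}`-square of Cor. 4.12 from the named fact Theorem 3.4 (iv)**, for Frobenioids of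
isotropic type (print p. 95 ll. 30–39): with `Ψ^birat := Birat.mapOfEquiv` (Cor. 4.10; as an equivalence
with quasi-inverse the `mapOfEquiv` of `Ψ⁻¹`, `Localization.equivalence`), "`Ψ^birat` preserves
base-isomorphisms" (Prop. 4.4 (iv) + Thm. 3.4 (iii); abc-iut-L6-t20's `Birat.isBaseIso_mapOfEquiv_map`)
supplies hypothesis (b) of Thm. 3.4 (iv) for `Ψ^birat`, whose clause "`Ψ` preserves `O^×(−)`" (the named
fact `FrdI.Thm34iv`, at the universes of the birationalizations) feeds the assembly
`exists_toBaseDeg_equivalence_of_birat_pieces`: there is an equivalence `Ψ⁰ : F_{0_{D₁}} ⥲ F_{0_{D₂}}`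
`1`-commuting with `Ψ` over the projections. [cite: MochizukiFrdI2008, Cor. 4.12 p.95] -/
theorem exists_toBaseDeg_equivalence_of_thm34iv (h34iv : Thm34iv.{w, v, max u' v', u, u'})
    (hF₁ : IsFrobenioid F₁) (hsq₁ : HasBiratSquares F₁) (hF₂ : IsFrobenioid F₂) (hsq₂ : HasBiratSquares F₂)
    (Ψ : C₁ ≌ C₂)
    (hB₁ : IsFrobenioid (Birat.toElemZero hF₁ hsq₁)) (hB₂ : IsFrobenioid (Birat.toElemZero hF₂ hsq₂))
    (hC₁ : (PreFrobenioidData.ofFunctor Φ₁ F₁).IsOfIsotropicType)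
    (hC₂ : (PreFrobenioidData.ofFunctor Φ₂ F₂).IsOfIsotropicType)
    (hstd₁ : (biratOps hF₁ hsq₁).IsOfStandardType) (hstd₂ : (biratOps hF₂ hsq₂).IsOfStandardType)
    (hfs₁ : IsFrobeniusSlim D₁) (hfs₂ : IsFrobeniusSlim D₂)
    (hΨ : ∀ ⦃A B : C₁⦄ (f : A ⟶ B), IsCoAngularPreStep F₁ f → IsCoAngularPreStep F₂ (Ψ.functor.map f))
    (hΨ' : ∀ ⦃A B : C₂⦄ (f : A ⟶ B), IsCoAngularPreStep F₂ f → IsCoAngularPreStep F₁ (Ψ.inverse.map f))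
    (hbi : PreFrobenioidData.PreservesMor Ψ.functor (PreFrobenioidData.ofFunctor Φ₁ F₁).IsBaseIso
      (PreFrobenioidData.ofFunctor Φ₂ F₂).IsBaseIso)
    (hbi' : PreFrobenioidData.PreservesMor Ψ.inverse (PreFrobenioidData.ofFunctor Φ₂ F₂).IsBaseIso
      (PreFrobenioidData.ofFunctor Φ₁ F₁).IsBaseIso) :
    ∃ Ψ0 : D₁ × SingleObj ℕ+ ⥤ D₂ × SingleObj ℕ+, Ψ0.IsEquivalence ∧
      OneCommutes Ψ.functor (PreFrobenioidData.ofFunctor Φ₂ F₂).toBaseDeg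
        (PreFrobenioidData.ofFunctor Φ₁ F₁).toBaseDeg Ψ0 := by
  -- `Ψ^birat` (Cor. 4.10) as an equivalence with functor `mapOfEquiv Ψ` and inverse `mapOfEquiv Ψ⁻¹`
  haveI := toBirat_isLocalization hF₁ hsq₁
  haveI := toBirat_isLocalization hF₂ hsq₂
  letI := Birat.liftingMapOfEquiv hF₁ hsq₁ hF₂ hsq₂ Ψ hΨ
  let F' : Birat F₂ hF₂ hsq₂ ⥤ Birat F₁ hF₁ hsq₁ := Birat.mapOfEquiv hF₂ hsq₂ hF₁ hsq₁ Ψ.symm hΨ'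
  let fac' : toBirat F₂ hF₂ hsq₂ ⋙ F' ≅ Ψ.inverse ⋙ toBirat F₁ hF₁ hsq₁ :=
    Birat.mapOfEquivFac hF₂ hsq₂ hF₁ hsq₁ Ψ.symm hΨ'
  letI : Localization.Lifting (toBirat F₂ hF₂ hsq₂) (coAngularPreSteps F₂)
      (Ψ.inverse ⋙ toBirat F₁ hF₁ hsq₁) F' := ⟨fac'⟩
  let α : (Ψ.functor ⋙ toBirat F₂ hF₂ hsq₂) ⋙ F' ≅ toBirat F₁ hF₁ hsq₁ :=
    Functor.associator _ _ _ ≪≫ Functor.isoWhiskerLeft Ψ.functor fac' ≪≫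
      (Functor.associator _ _ _).symm ≪≫ Functor.isoWhiskerRight Ψ.unitIso.symm _ ≪≫
        Functor.leftUnitor _
  let β : (Ψ.inverse ⋙ toBirat F₁ hF₁ hsq₁) ⋙ Birat.mapOfEquiv hF₁ hsq₁ hF₂ hsq₂ Ψ hΨ ≅
      toBirat F₂ hF₂ hsq₂ :=
    Functor.associator _ _ _ ≪≫
      Functor.isoWhiskerLeft Ψ.inverse (Birat.mapOfEquivFac hF₁ hsq₁ hF₂ hsq₂ Ψ hΨ) ≪≫
        (Functor.associator _ _ _).symm ≪≫ Functor.isoWhiskerRight Ψ.counitIso _ ≪≫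
          Functor.leftUnitor _
  let Eb : Birat F₁ hF₁ hsq₁ ≌ Birat F₂ hF₂ hsq₂ :=
    Localization.equivalence (toBirat F₁ hF₁ hsq₁) (coAngularPreSteps F₁) (toBirat F₂ hF₂ hsq₂)
      (coAngularPreSteps F₂) (Ψ.functor ⋙ toBirat F₂ hF₂ hsq₂) (Birat.mapOfEquiv hF₁ hsq₁ hF₂ hsq₂ Ψ hΨ)
      (Ψ.inverse ⋙ toBirat F₁ hF₁ hsq₁) F' α β
  -- (b) for `Ψ^birat`: base-isomorphisms are preserved (Prop. 4.4 (iv) + Thm. 3.4 (iii); abc-iut-L6-t20)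
  have hpres : PreFrobenioidData.PreservesMor Eb.functor (biratOps hF₁ hsq₁).IsBaseIso
      (biratOps hF₂ hsq₂).IsBaseIso :=
    fun X Y g hg => Birat.isBaseIso_mapOfEquiv_map hF₁ hsq₁ hF₂ hsq₂ Ψ hΨ hbi g hg
  have hpres' : PreFrobenioidData.PreservesMor Eb.inverse (biratOps hF₂ hsq₂).IsBaseIso
      (biratOps hF₁ hsq₁).IsBaseIso :=
    fun X Y g hg => Birat.isBaseIso_mapOfEquiv_map hF₂ hsq₂ hF₁ hsq₁ Ψ.symm hΨ' hbi' g hg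
  have hHypB : (biratOps hF₁ hsq₁).HypB (biratOps hF₂ hsq₂) Eb := fun _ _ => ⟨hpres, hpres'⟩
  have hHypB' : (biratOps hF₂ hsq₂).HypB (biratOps hF₁ hsq₁) Eb.symm := fun _ _ => ⟨hpres', hpres⟩
  -- Thm. 3.4 (iv) for `Ψ^birat` and for its quasi-inverse: `O^×(−)` is preserved
  obtain ⟨-, hu, -⟩ := h34iv (Birat.toElemZero hF₁ hsq₁) (Birat.toElemZero hF₂ hsq₂) hB₁ hB₂ Eb
    hstd₁ hstd₂ hHypB hfs₁ hfs₂
  obtain ⟨-, hu', -⟩ := h34iv (Birat.toElemZero hF₂ hsq₂) (Birat.toElemZero hF₁ hsq₁) hB₂ hB₁ Eb.symm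
    hstd₂ hstd₁ hHypB' hfs₂ hfs₁
  exact exists_toBaseDeg_equivalence_of_birat_pieces hF₁ hsq₁ hF₂ hsq₂ Ψ hB₁ hB₂ hstd₁.fsmff hstd₂.fsmff
    (PreFrobenioidData.isOfIsotropicType_ofFunctor_toElemZero hF₁ hsq₁ hC₁)
    (PreFrobenioidData.isOfIsotropicType_ofFunctor_toElemZero hF₂ hsq₂ hC₂) Eb
    (Birat.mapOfEquivFac hF₁ hsq₁ hF₂ hsq₂ Ψ hΨ) hu hu'

end Isotropic

section General

variable {D₁ : Type u} [Category.{v} D₁] {Φ₁ : D₁ᵒᵖ ⥤ CommMonCat.{w}}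
  {C₁ : Type u'} [Category.{v'} C₁] {F₁ : C₁ ⥤ ElemFrobenioid Φ₁}
  {D₂ : Type u} [Category.{v} D₂] {Φ₂ : D₂ᵒᵖ ⥤ CommMonCat.{w}}
  {C₂ : Type u'} [Category.{v'} C₂] {F₂ : C₂ ⥤ ElemFrobenioid Φ₂}

/-- **[FrdI] Corollary 4.12 for an arbitrary pair of Frobenioids, from the named fact Theorem 3.4 (iv)**
(print p. 95 ll. 18–40: "we may assume without loss of generality that `C₁`, `C₂` are of isotropic type
[cf. Theorem 3.4, (i)] … Corollary 4.12 follows by applying Corollary 4.10 …, followed by Theorem 3.4,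
(iv) …"): let `Ψ^istr : C₁^istr ⥲ C₂^istr` be compatible with `Ψ` through the isotropification functors
(Thm. 3.4 (i); in the tree `nonempty_isotropification_comp_iso`). GIVEN the named fact `FrdI.Thm34iv` and,
at the Frobenioids `C_i^istr` of isotropic type: THE birationalizations `(C_i^istr)^birat` with their
Frobenioid structures over `0_{D_i}` (Prop. 4.4 (ii), `hB_i`) of standard type (Prop. 4.8 (iii), `hstd_i`),
Frobenius-slim bases `D_i` (the hypothesis of Cor. 4.12), and `Ψ^istr`, `(Ψ^istr)⁻¹` preserving co-angular
pre-steps (Thm. 3.4 (ii), `hΨ`, `hΨ'`) and base-isomorphisms (Thm. 3.4 (iii), `hbi`, `hbi'`) — the typed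
Cor. 4.12 (`PreFrobenioidData.Cor412`) holds for `Ψ` itself, for all parameters `R_i`: a `1`-unique
`Ψ⁰ : F_{0_{D₁}} ⥲ F_{0_{D₂}}` `1`-commuting with `Ψ` over `C_i → F_{0_{D_i}}`, and rigid composites over slim
bases. [cite: MochizukiFrdI2008, Cor. 4.12 p.95] -/
theorem cor412_of_thm34iv_istr (h34iv : Thm34iv.{w, v, max u' v', u, u'})
    (hF₁ : IsFrobenioid F₁) (hF₂ : IsFrobenioid F₂) (Ψ : C₁ ≌ C₂)
    (Ψi : Istr F₁ ≌ Istr F₂) (core : isotropification hF₁ ⋙ Ψi.functor ≅ Ψ.functor ⋙ isotropification hF₂)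
    (hsq₁ : HasBiratSquares (istrFunctor F₁)) (hsq₂ : HasBiratSquares (istrFunctor F₂))
    (hB₁ : IsFrobenioid (Birat.toElemZero (isFrobenioid_istr hF₁) hsq₁))
    (hB₂ : IsFrobenioid (Birat.toElemZero (isFrobenioid_istr hF₂) hsq₂))
    (hstd₁ : (biratOps (isFrobenioid_istr hF₁) hsq₁).IsOfStandardType)
    (hstd₂ : (biratOps (isFrobenioid_istr hF₂) hsq₂).IsOfStandardType)
    (hfs₁ : IsFrobeniusSlim D₁) (hfs₂ : IsFrobeniusSlim D₂)
    (hΨ : ∀ ⦃A B : Istr F₁⦄ (f : A ⟶ B),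
      IsCoAngularPreStep (istrFunctor F₁) f → IsCoAngularPreStep (istrFunctor F₂) (Ψi.functor.map f))
    (hΨ' : ∀ ⦃A B : Istr F₂⦄ (f : A ⟶ B),
      IsCoAngularPreStep (istrFunctor F₂) f → IsCoAngularPreStep (istrFunctor F₁) (Ψi.inverse.map f))
    (hbi : PreFrobenioidData.PreservesMor Ψi.functor (PreFrobenioidData.ofFunctor Φ₁ (istrFunctor F₁)).IsBaseIso
      (PreFrobenioidData.ofFunctor Φ₂ (istrFunctor F₂)).IsBaseIso)
    (hbi' : PreFrobenioidData.PreservesMor Ψi.inverse (PreFrobenioidData.ofFunctor Φ₂ (istrFunctor F₂)).IsBaseIso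
      (PreFrobenioidData.ofFunctor Φ₁ (istrFunctor F₁)).IsBaseIso)
    (R₁ : (PreFrobenioidData.ofFunctor Φ₁ F₁).RSParams) (R₂ : (PreFrobenioidData.ofFunctor Φ₂ F₂).RSParams) :
    (PreFrobenioidData.ofFunctor Φ₁ F₁).Cor412 (PreFrobenioidData.ofFunctor Φ₂ F₂) Ψ R₁ R₂ :=
  cor412_of_istr hF₁ hF₂ Ψ Ψi core
    (exists_toBaseDeg_equivalence_of_thm34iv h34iv (isFrobenioid_istr hF₁) hsq₁ (isFrobenioid_istr hF₂) hsq₂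
      Ψi hB₁ hB₂
      ((PreFrobenioidData.ofFunctor_isOfIsotropicType _).2 isOfIsotropicType_istr)
      ((PreFrobenioidData.ofFunctor_isOfIsotropicType _).2 isOfIsotropicType_istr)
      hstd₁ hstd₂ hfs₁ hfs₂ hΨ hΨ' hbi hbi')
    R₁ R₂

end General

end FrdI

end Literature.AlgebraicGeometry.Frobenioids
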